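import Literature.Geometry.Lorentzian.KerrPriceLaw
import Literature.Geometry.Lorentzian.KerrSliceHardy
import Literature.Geometry.Lorentzian.KerrSliceBall
import HarnessLib

/-!
# DRSR Corollary 3.1 (30) from (31) and the late-time asymptotics: the gr.S24 fact
# `drsr_wave_pointwise_decay_kerr` is implied by three other named facts of the tree

(statement group **gr.S24**; namespace `Literature.Geometry.Lorentzian`)

`KerrWaveDecay.lean` vendors two of the five estimates of Dafermos–Rodnianski–Shlapentokh-Rothman
(arXiv:1402.7034 = Ann. of Math. 183 (2016), Cor. 3.1) as named facts in coordinate form: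
`drsr_wave_pointwise_decay_kerr` ((30): `|ψ(τ, y)| ≤ C τ^{-3/2+δ}` on `{‖y‖ ≤ R}`) and
`drsr_wave_derivative_decay_kerr` ((31): `∑_μ (∂_μψ̃)²(τ, y) ≤ C τ^{-4+2δ}` on `{‖y‖ ≤ R}`), and
`KerrPriceLaw.lean` vendors the late-time asymptotics of Hintz (arXiv:2004.01664 = Comm. Math.
Phys. 389 (2022), Thm. 4.5) in limit form (`hintz_priceLaw_forcedWave_kerr`), deriving from it and
the domain-of-dependence fact `kerr_domainOfDependence_ball` that every admissible wave satisfies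
`τ³ ψ(τ, x⃗) → c` along each `∂_{t*}`-line (`IsAdmissibleKerrWave.priceLaw_limit`). This file
**proves** that these three named facts together imply `drsr_wave_pointwise_decay_kerr`:

* `drsr_wave_pointwise_decay_kerr_of_derivative_decay_of_priceLaw` (**proved**).

The argument is soft and is *not* DRSR's derivation of (30) (which is the interpolation on the
hyperboloidal leaves formalised in `KerrPointwiseDecayHierarchy.lean`, `KerrSliceAgmon.lean`,
`KerrLeafCoercivity.lean`): fix `R' = max(R, 2A)` with `A = Kerr.afRadius a r₊` (so that
`{‖z‖ > A} ⊆ {r > r₊}`, `Kerr.mem_slice_of_lt_norm`) and the point `y₀ = R' e₀` of the slice. By the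
limit form of Price's law, `τ³ ψ(τ, y₀)` converges, hence is bounded on `[1, ∞)` (it is continuous):
`|ψ(τ, y₀)| ≤ B τ⁻³`. By (31) the slice gradient of `ψ̃(τ, ·)` is at most `√C τ^{-2+δ}` on
`{r > r₊} ∩ {‖z‖ ≤ R'}`, and every `y` in this set is joined to `y₀` inside it by three segments of
total length `≤ 6R'` — the radial segment from `y` to `ŷ = R' y/‖y‖` (the exterior slice is the
complement of a closed convex set containing the origin, `Kerr.coe_slice_rPlus_eq_compl_closure`,
hence invariant under dilations `s ≥ 1`), and the chords `[ŷ, ±R' e₁]`, `[±R' e₁, R' e₀]` between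
points of the sphere of radius `R'` at non-obtuse angles, which stay in `{‖z‖ ≥ R'/√2 > A}` —, so
the mean value inequality gives `|ψ(τ, y)| ≤ B τ⁻³ + 6R' √C τ^{-2+δ} ≤ (B + 6R'√C) τ^{-3/2+δ}` for
`τ ≥ 1` (in fact the rate `τ^{-2+δ}`). The point is book-keeping for the ledger of named facts
(D-0026): given Hintz's theorem and (31), the estimate (30) carries no proof obligation of its own.
Everything below is proved; no named facts are introduced.

## References

* M. Dafermos, I. Rodnianski, Y. Shlapentokh-Rothman, arXiv:1402.7034 = Ann. of Math. 183 (2016),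
  Cor. 3.1 (30), (31) (key `DafermosRodnianskiShlapentokhrothman2014`).
* P. Hintz, *A sharp version of Price's law for wave decay on asymptotically flat spacetimes*,
  arXiv:2004.01664 = Comm. Math. Phys. 389 (2022), Thm. 4.5 (key `Hintz2021`).
-/

noncomputable section

open Set Filter Metric Topology
open scoped Topology Manifold ContDiff RealInnerProductSpace

namespace Literature.Geometry.Lorentzian

namespace Kerr

/-! ### Segments inside the exterior slice -/

/-- **The exterior slice is invariant under dilations `s ≥ 1`**: it is the complement of the closed
solid horizon ellipsoid `{q ≤ 1}`, a closed convex set containing the origin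
(`coe_slice_rPlus_eq_compl_closure`, `convex_horizonEllipsoidInterior`). [folklore] -/
theorem smul_mem_slice_rPlus {M a : ℝ} (hMa : IsSubextremal M a) {y : E3}
    (hy : y ∈ (slice a (rPlus M a) : Set E3)) {s : ℝ} (hs : 1 ≤ s) :
    s • y ∈ (slice a (rPlus M a) : Set E3) := by
  rw [coe_slice_rPlus_eq_compl_closure hMa] at hy ⊢
  intro hsy
  apply hy
  have hconv : Convex ℝ (closure (horizonEllipsoidInterior M a : Set E3)) :=
    (convex_horizonEllipsoidInterior M a).closure
  have h0 : (0 : E3) ∈ closure (horizonEllipsoidInterior M a : Set E3) := by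
    rw [closure_horizonEllipsoidInterior]
    show horizonQuadric M a 0 ≤ 1
    simp [horizonQuadric]
  have hs0 : 0 < s := by linarith
  have hy_eq : y = (1 / s) • (s • y) + (1 - 1 / s) • (0 : E3) := by
    rw [smul_smul, smul_zero, add_zero, one_div, inv_mul_cancel₀ hs0.ne', one_smul]
  rw [hy_eq]
  refine hconv hsy h0 (by positivity) ?_ (by ring)
  rw [sub_nonneg, div_le_one hs0]
  exact hs

/-- **The radial segment** from a point `y` of the exterior slice to the point `ŷ = (R'/‖y‖) y` of
the sphere of radius `R' ≥ ‖y‖` lies in the slice and in the closed ball of radius `R'`. [folklore] -/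
theorem radial_segment_subset {M a : ℝ} (hMa : IsSubextremal M a) {y : E3}
    (hy : y ∈ (slice a (rPlus M a) : Set E3)) {R' : ℝ} (hyR : ‖y‖ ≤ R') :
    segment ℝ y ((R' / ‖y‖) • y) ⊆ {z | z ∈ (slice a (rPlus M a) : Set E3) ∧ ‖z‖ ≤ R'} := by
  have hy0 : y ≠ 0 := by
    rintro rfl
    have h : rPlus M a < radius a (E4.ofTimeSpace 0 (0 : E3)) :=
      lt_radius_of_mem_region (ofTimeSpace_mem_region_iff.2 hy)
    have h0 : radius a (E4.ofTimeSpace 0 (0 : E3)) ≤ ‖(0 : E3)‖ := radius_ofTimeSpace_le_norm a 0 0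
    rw [norm_zero] at h0
    linarith [hMa.rPlus_pos]
  have hny : 0 < ‖y‖ := norm_pos_iff.2 hy0
  have hq : 1 ≤ R' / ‖y‖ := by rw [le_div_iff₀ hny, one_mul]; exact hyR
  rw [segment_subset_iff]
  intro p q hp hq0 hpq
  have hcoef : p • y + q • ((R' / ‖y‖) • y) = (p + q * (R' / ‖y‖)) • y := by
    rw [smul_smul, ← add_smul]
  rw [hcoef]
  have h1 : 1 ≤ p + q * (R' / ‖y‖) := by nlinarith
  refine ⟨smul_mem_slice_rPlus hMa hy h1, ?_⟩
  rw [norm_smul, Real.norm_eq_abs, abs_of_nonneg (by linarith)]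
  have : (p + q * (R' / ‖y‖)) * ‖y‖ = p * ‖y‖ + q * R' := by
    field_simp
  rw [this]
  nlinarith

/-- **Chords at non-obtuse angles stay far out**: for `‖p‖ = ‖q‖ = R'` with `⟪p, q⟫ ≥ 0`, every
point `z` of the segment `[p, q]` has `R'²/2 ≤ ‖z‖²` and `‖z‖ ≤ R'`. [folklore] -/
theorem chord_norm_bounds {p q : E3} {R' : ℝ} (hp : ‖p‖ = R') (hq : ‖q‖ = R')
    (hpq : 0 ≤ ⟪p, q⟫) {z : E3} (hz : z ∈ segment ℝ p q) :
    R' ^ 2 / 2 ≤ ‖z‖ ^ 2 ∧ ‖z‖ ≤ R' := by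
  rw [segment_eq_image'] at hz
  obtain ⟨t, ht, rfl⟩ := hz
  have hR : 0 ≤ R' := hp ▸ norm_nonneg p
  constructor
  · have hexp : ‖p + t • (q - p)‖ ^ 2 =
        (1 - t) ^ 2 * ‖p‖ ^ 2 + t ^ 2 * ‖q‖ ^ 2 + 2 * ((1 - t) * t) * ⟪p, q⟫ := by
      have : p + t • (q - p) = (1 - t) • p + t • q := by
        rw [smul_sub, sub_smul, one_smul]; abel
      rw [this, ← real_inner_self_eq_norm_sq, ← real_inner_self_eq_norm_sq,
        ← real_inner_self_eq_norm_sq]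
      simp only [inner_add_left, inner_add_right, real_inner_smul_left, real_inner_smul_right,
        real_inner_comm q p]
      ring
    rw [hexp, hp, hq]
    have h1 : 0 ≤ 2 * ((1 - t) * t) * ⟪p, q⟫ :=
      mul_nonneg (mul_nonneg zero_le_two (mul_nonneg (by linarith [ht.2]) ht.1)) hpq
    nlinarith [sq_nonneg (1 - 2 * t), sq_nonneg R']
  · calc ‖p + t • (q - p)‖ = ‖(1 - t) • p + t • q‖ := by
          congr 1; rw [smul_sub, sub_smul, one_smul]; abel
      _ ≤ ‖(1 - t) • p‖ + ‖t • q‖ := norm_add_le _ _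
      _ = (1 - t) * R' + t * R' := by
          rw [norm_smul, norm_smul, Real.norm_eq_abs, Real.norm_eq_abs,
            abs_of_nonneg (by linarith [ht.2]), abs_of_nonneg ht.1, hp, hq]
      _ = R' := by ring

/-- Such a chord lies in the exterior slice and in the closed ball of radius `R'` as soon as
`R' ≥ 2A`, `A = Kerr.afRadius a r₊` (`‖z‖ ≥ R'/√2 > A`, `Kerr.mem_slice_of_lt_norm`). [folklore] -/
theorem chord_subset {M a : ℝ} {p q : E3} {R' : ℝ} (hR : 2 * afRadius a (rPlus M a) ≤ R')
    (hp : ‖p‖ = R') (hq : ‖q‖ = R') (hpq : 0 ≤ ⟪p, q⟫) :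
    segment ℝ p q ⊆ {z | z ∈ (slice a (rPlus M a) : Set E3) ∧ ‖z‖ ≤ R'} := by
  intro z hz
  obtain ⟨h1, h2⟩ := chord_norm_bounds hp hq hpq hz
  refine ⟨mem_slice_of_lt_norm ?_, h2⟩
  have hA := afRadius_pos a (rPlus M a)
  have hA2 : afRadius a (rPlus M a) ^ 2 < ‖z‖ ^ 2 := by nlinarith
  exact lt_of_pow_lt_pow_left₀ 2 (norm_nonneg z) hA2

/-! ### The mean value inequality along the slices of an admissible wave -/

/-- **Mean value inequality on a segment of the slice shell**: if the segment `[p, q]` lies in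
`{r > r₊} ∩ {‖z‖ ≤ R'}` and the coordinate energy density of the (smooth) `ψ` at time `τ` is at most
`K` there, then `|ψ̃(τ, q) − ψ̃(τ, p)| ≤ √K ‖q − p‖` (`‖∇_y ψ̃(τ, ·)‖² ≤ ∑_μ (∂_μψ̃)²`,
`norm_fderiv_slice_sq_le`). [folklore] -/
theorem abs_sub_le_sqrt_mul_of_segment [Facts] [SliceFacts] {M a : ℝ} {ψ : exterior M a → ℝ}
    (hψ : ContMDiff 𝓘(ℝ, E4) 𝓘(ℝ, ℝ) ∞ ψ) {τ R' K : ℝ} {p q : E3}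
    (hseg : segment ℝ p q ⊆ {z | z ∈ (slice a (rPlus M a) : Set E3) ∧ ‖z‖ ≤ R'})
    (hK : ∀ z : E3, E4.ofTimeSpace τ z ∈ exterior M a → ‖z‖ ≤ R' →
      coordEnergyDensity (exterior M a) ψ (E4.ofTimeSpace τ z) ≤ K) :
    |Function.extend Subtype.val ψ 0 (E4.ofTimeSpace τ q) -
        Function.extend Subtype.val ψ 0 (E4.ofTimeSpace τ p)| ≤ Real.sqrt K * ‖q - p‖ := by
  set f : E3 → ℝ := fun z ↦ Function.extend Subtype.val ψ 0 (E4.ofTimeSpace τ z) with hf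
  have hdiff : ∀ z ∈ segment ℝ p q, DifferentiableAt ℝ f z := by
    intro z hz
    have hx : E4.ofTimeSpace τ z ∈ exterior M a := ofTimeSpace_mem_region_iff.2 (hseg hz).1
    exact ((contDiffAt_extend hψ ⟨_, hx⟩).differentiableAt (by simp)).comp z
      (E4.hasFDerivAt_ofTimeSpace τ z).differentiableAt
  have hbound : ∀ z ∈ segment ℝ p q, ‖fderiv ℝ f z‖ ≤ Real.sqrt K := by
    intro z hz
    have hx : E4.ofTimeSpace τ z ∈ exterior M a := ofTimeSpace_mem_region_iff.2 (hseg hz).1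
    have hd : DifferentiableAt ℝ (Function.extend Subtype.val ψ 0) (E4.ofTimeSpace τ z) :=
      (contDiffAt_extend hψ ⟨_, hx⟩).differentiableAt (by simp)
    have h1 := norm_fderiv_slice_sq_le (Function.extend Subtype.val ψ 0) τ z hd
    have h2 : ‖fderiv ℝ f z‖ ^ 2 ≤ K := h1.trans (hK z hx (hseg hz).2)
    exact Real.le_sqrt_of_sq_le h2
  have h := (convex_segment p q).norm_image_sub_le_of_norm_fderiv_le hdiff hbound
    (left_mem_segment ℝ p q) (right_mem_segment ℝ p q)
  rw [Real.norm_eq_abs] at h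
  exact h

end Kerr

open Kerr

/-! ### (30) from (31) and the late-time asymptotics -/

/-- **The gr.S24 fact `drsr_wave_pointwise_decay_kerr` (DRSR Cor. 3.1 (30)) from
`drsr_wave_derivative_decay_kerr` (Cor. 3.1 (31)), Hintz's Price-law asymptotics
`hintz_priceLaw_forcedWave_kerr` (limit form) and the domain of dependence
`kerr_domainOfDependence_ball`.** One-point decay `|ψ(τ, y₀)| ≤ B τ⁻³`
(`IsAdmissibleKerrWave.priceLaw_limit`, continuity on `[1, ∞)`), uniform gradient decay
`‖∇_yψ̃(τ, ·)‖ ≤ √C τ^{-2+δ}` on `{r > r₊} ∩ {‖z‖ ≤ R'}` ((31)), and paths of length `≤ 6R'` inside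
this set (module docstring) give `|ψ(τ, y)| ≤ (B + 6R'√C) τ^{-3/2+δ}` for `τ ≥ 1`, `‖y‖ ≤ R ≤ R'`.
A soft argument recorded for the book-keeping of named facts; it is not DRSR's derivation of (30)
(for which see `KerrLeafCoercivity.lean` and the files cited there). [cite: DafermosRodnianskiShlapentokhrothman2014, Cor. 3.1 (30) (31); Hintz2021 Thm. 4.5] -/
theorem drsr_wave_pointwise_decay_kerr_of_derivative_decay_of_priceLaw
    (h31 : drsr_wave_derivative_decay_kerr) (hA : hintz_priceLaw_forcedWave_kerr)
    (hB : kerr_domainOfDependence_ball) : drsr_wave_pointwise_decay_kerr := by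
  intro _ _ M a hMa ψ hψ δ hδ R
  -- the radius `R'` and the base point `y₀ = R' e₀`
  obtain ⟨A, hA_def⟩ : ∃ A : ℝ, A = afRadius a (rPlus M a) := ⟨_, rfl⟩
  have hApos : 0 < A := hA_def ▸ afRadius_pos a (rPlus M a)
  obtain ⟨R', hR'⟩ : ∃ R' : ℝ, R' = max R (2 * A) := ⟨_, rfl⟩
  have hRR' : R ≤ R' := hR' ▸ le_max_left _ _
  have h2A : 2 * A ≤ R' := hR' ▸ le_max_right _ _
  have h2A' : 2 * afRadius a (rPlus M a) ≤ R' := hA_def ▸ h2A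
  have hR'pos : 0 < R' := by linarith
  have hne₀ : ‖(EuclideanSpace.single 0 1 : E3)‖ = 1 := by simp
  have hne₁ : ‖(EuclideanSpace.single 1 1 : E3)‖ = 1 := by simp
  have he₀₁ : ⟪(EuclideanSpace.single 1 1 : E3), (EuclideanSpace.single 0 1 : E3)⟫ = (0 : ℝ) := by
    simp [EuclideanSpace.inner_single_left]
  obtain ⟨y₀, hy₀⟩ : ∃ y₀ : E3, y₀ = R' • (EuclideanSpace.single 0 1 : E3) := ⟨_, rfl⟩
  have hny₀ : ‖y₀‖ = R' := by
    rw [hy₀, norm_smul, hne₀, mul_one, Real.norm_eq_abs, abs_of_pos hR'pos]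
  have hy₀A : afRadius a (rPlus M a) < ‖y₀‖ := by rw [hny₀]; linarith
  have hy₀s : y₀ ∈ (slice a (rPlus M a) : Set E3) := mem_slice_of_lt_norm hy₀A
  -- the extension `ψ̃` and its values along the `∂_{t*}`-line through `y₀`
  obtain ⟨ψt, hψt⟩ : ∃ ψt : E4 → ℝ, ψt = Function.extend Subtype.val ψ 0 := ⟨_, rfl⟩
  have hrep : ∀ x : exterior M a, ψ x = ψt x := fun x ↦ hψt ▸ extend_rep ψ x
  have hsm : ∀ x : exterior M a, ContDiffAt ℝ ∞ ψt x := fun x ↦ hψt ▸ contDiffAt_extend hψ.contMDiff x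
  have hmem₀ : ∀ τ : ℝ, E4.ofTimeSpace τ y₀ ∈ exterior M a := fun τ ↦
    ofTimeSpace_mem_region_iff.2 hy₀s
  -- Price's law, limit form, at `y₀`: `τ³ ψ(τ, y₀) → c`
  obtain ⟨c, hc⟩ := hψ.priceLaw_limit hA hB hMa
  have hlim : Tendsto (fun τ : ℝ ↦ τ ^ 3 * ψt (E4.ofTimeSpace τ y₀)) atTop (𝓝 c) := by
    have h := hc ⟨E4.ofTimeSpace 0 y₀, hmem₀ 0⟩
    refine h.congr fun τ ↦ ?_
    rw [hrep]
    simp only [E4.spatial_ofTimeSpace]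
  -- continuity of `τ ↦ τ³ ψ̃(τ, y₀)`
  have hcont : Continuous fun τ : ℝ ↦ τ ^ 3 * ψt (E4.ofTimeSpace τ y₀) := by
    refine (continuous_pow 3).mul ?_
    refine continuous_iff_continuousAt.2 fun τ ↦ ?_
    have hg : ContinuousAt ψt (E4.ofTimeSpace τ y₀) := (hsm ⟨_, hmem₀ τ⟩).continuousAt
    exact ContinuousAt.comp (f := fun t : ℝ ↦ E4.ofTimeSpace t y₀) (x := τ) hg
      (continuous_ofTimeSpace_left y₀).continuousAt
  -- boundedness on `[1, ∞)`: `|τ³ ψ̃(τ, y₀)| ≤ B`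
  obtain ⟨B, hB0, hBbd⟩ : ∃ B : ℝ, 0 ≤ B ∧
      ∀ τ : ℝ, 1 ≤ τ → |τ ^ 3 * ψt (E4.ofTimeSpace τ y₀)| ≤ B := by
    have hev : ∀ᶠ τ in atTop, |τ ^ 3 * ψt (E4.ofTimeSpace τ y₀)| ≤ |c| + 1 :=
      hlim.abs.eventually_le_const (by linarith [abs_nonneg c])
    obtain ⟨T, hT⟩ := eventually_atTop.1 hev
    obtain ⟨B₁, hB₁⟩ := (isCompact_Icc (a := (1 : ℝ)) (b := max T 1)).exists_bound_of_continuousOn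
      hcont.continuousOn
    refine ⟨max (max B₁ (|c| + 1)) 0, le_max_right _ _, fun τ hτ ↦ ?_⟩
    by_cases hτT : τ ≤ max T 1
    · have := hB₁ τ ⟨hτ, hτT⟩
      rw [Real.norm_eq_abs] at this
      exact this.trans ((le_max_left _ _).trans (le_max_left _ _))
    · have hTτ : T ≤ τ := (le_max_left _ _).trans (not_le.1 hτT).le
      exact (hT τ hTτ).trans ((le_max_right _ _).trans (le_max_left _ _))
  -- (31) on `{‖z‖ ≤ R'}` with the given `δ`: the constant `K ≥ 0`
  obtain ⟨C₁, hC₁⟩ := h31 M a hMa ψ hψ δ hδ R'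
  obtain ⟨K, hK⟩ : ∃ K : ℝ, K = max C₁ 0 := ⟨_, rfl⟩
  have hK0 : 0 ≤ K := hK ▸ le_max_right _ _
  have hCK : C₁ ≤ K := hK ▸ le_max_left _ _
  -- the constant
  refine ⟨B + 6 * R' * Real.sqrt K, fun τ hτ y hy hyR ↦ ?_⟩
  have hτ0 : 0 < τ := by linarith
  have hys : y ∈ (slice a (rPlus M a) : Set E3) := ofTimeSpace_mem_region_iff.1 hy
  have hyR' : ‖y‖ ≤ R' := hyR.trans hRR'
  -- the gradient bound at time `τ` on the shell
  have hgrad : ∀ z : E3, E4.ofTimeSpace τ z ∈ exterior M a → ‖z‖ ≤ R' →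
      coordEnergyDensity (exterior M a) ψ (E4.ofTimeSpace τ z) ≤ K * τ ^ (-4 + 2 * δ) :=
    fun z hz hzR ↦ (hC₁ τ hτ z hz hzR).trans
      (mul_le_mul_of_nonneg_right hCK (Real.rpow_nonneg hτ0.le _))
  have hsqrt : Real.sqrt (K * τ ^ (-4 + 2 * δ)) = Real.sqrt K * τ ^ (-2 + δ) := by
    rw [Real.sqrt_mul hK0]
    congr 1
    rw [Real.sqrt_eq_rpow, ← Real.rpow_mul hτ0.le]
    congr 1
    ring
  -- the path `y → ŷ → v₁ → y₀`
  have hny : 0 < ‖y‖ := by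
    refine norm_pos_iff.2 ?_
    rintro rfl
    have h : rPlus M a < radius a (E4.ofTimeSpace τ (0 : E3)) := lt_radius_of_mem_region hy
    have h0 : radius a (E4.ofTimeSpace τ (0 : E3)) ≤ ‖(0 : E3)‖ := radius_ofTimeSpace_le_norm a τ 0
    rw [norm_zero] at h0
    linarith [hMa.rPlus_pos]
  obtain ⟨yh, hyh⟩ : ∃ yh : E3, yh = (R' / ‖y‖) • y := ⟨_, rfl⟩
  have hnyh : ‖yh‖ = R' := by
    rw [hyh, norm_smul, Real.norm_eq_abs, abs_of_nonneg (by positivity), div_mul_cancel₀ _ hny.ne']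
  -- the intermediate sphere point `v₁ = ± R' e₁`, sign that of `⟪ŷ, e₁⟫`
  obtain ⟨sg, hsg1, hsg⟩ : ∃ sg : ℝ, |sg| = 1 ∧ 0 ≤ sg * ⟪yh, (EuclideanSpace.single 1 1 : E3)⟫ := by
    by_cases hsgn : 0 ≤ ⟪yh, (EuclideanSpace.single 1 1 : E3)⟫
    · exact ⟨1, abs_one, by rw [one_mul]; exact hsgn⟩
    · refine ⟨-1, by rw [abs_neg, abs_one], ?_⟩
      rw [neg_one_mul, neg_nonneg]
      exact (not_le.1 hsgn).le
  obtain ⟨v₁, hv₁⟩ : ∃ v₁ : E3, v₁ = (sg * R') • (EuclideanSpace.single 1 1 : E3) := ⟨_, rfl⟩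
  have hnv₁ : ‖v₁‖ = R' := by
    rw [hv₁, norm_smul, hne₁, mul_one, Real.norm_eq_abs, abs_mul, hsg1, one_mul, abs_of_pos hR'pos]
  have hv₁y : 0 ≤ ⟪yh, v₁⟫ := by
    rw [hv₁, real_inner_smul_right]
    have : sg * R' * ⟪yh, (EuclideanSpace.single 1 1 : E3)⟫ =
        R' * (sg * ⟪yh, (EuclideanSpace.single 1 1 : E3)⟫) := by ring
    rw [this]
    exact mul_nonneg hR'pos.le hsg
  have hv₁e : 0 ≤ ⟪v₁, y₀⟫ := by
    rw [hv₁, hy₀, real_inner_smul_left, real_inner_smul_right, he₀₁, mul_zero, mul_zero]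
  -- the three segments lie in the shell
  have hseg₁ : segment ℝ y yh ⊆ {z | z ∈ (slice a (rPlus M a) : Set E3) ∧ ‖z‖ ≤ R'} :=
    hyh ▸ radial_segment_subset hMa hys hyR'
  have hseg₂ : segment ℝ yh v₁ ⊆ {z | z ∈ (slice a (rPlus M a) : Set E3) ∧ ‖z‖ ≤ R'} :=
    chord_subset h2A' hnyh hnv₁ hv₁y
  have hseg₃ : segment ℝ v₁ y₀ ⊆ {z | z ∈ (slice a (rPlus M a) : Set E3) ∧ ‖z‖ ≤ R'} :=
    chord_subset h2A' hnv₁ hny₀ hv₁e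
  -- the mean value inequality on each segment
  have hψs := hψ.contMDiff
  have m₁ := abs_sub_le_sqrt_mul_of_segment hψs hseg₁ hgrad
  have m₂ := abs_sub_le_sqrt_mul_of_segment hψs hseg₂ hgrad
  have m₃ := abs_sub_le_sqrt_mul_of_segment hψs hseg₃ hgrad
  rw [hsqrt, ← hψt] at m₁ m₂ m₃
  -- lengths of the segments (each at most `2R'`)
  have hG : 0 ≤ Real.sqrt K * τ ^ (-2 + δ) :=
    mul_nonneg (Real.sqrt_nonneg _) (Real.rpow_nonneg hτ0.le _)
  have d₁ : ‖yh - y‖ ≤ 2 * R' :=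
    (norm_sub_le _ _).trans (by rw [hnyh]; linarith)
  have d₂ : ‖v₁ - yh‖ ≤ 2 * R' :=
    (norm_sub_le _ _).trans (by rw [hnv₁, hnyh]; linarith)
  have d₃ : ‖y₀ - v₁‖ ≤ 2 * R' :=
    (norm_sub_le _ _).trans (by rw [hny₀, hnv₁]; linarith)
  have m₁' := m₁.trans (mul_le_mul_of_nonneg_left d₁ hG)
  have m₂' := m₂.trans (mul_le_mul_of_nonneg_left d₂ hG)
  have m₃' := m₃.trans (mul_le_mul_of_nonneg_left d₃ hG)
  -- the one-point bound at `y₀`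
  have hτe3 : τ ^ (-(3 : ℝ)) ≤ τ ^ (-(3 / 2 : ℝ) + δ) :=
    Real.rpow_le_rpow_of_exponent_le hτ (by linarith)
  have hτe2 : τ ^ (-2 + δ) ≤ τ ^ (-(3 / 2 : ℝ) + δ) :=
    Real.rpow_le_rpow_of_exponent_le hτ (by linarith)
  have hpt : |ψt (E4.ofTimeSpace τ y₀)| ≤ B * τ ^ (-(3 / 2 : ℝ) + δ) := by
    have h1 := hBbd τ hτ
    have hτ3 : 0 < τ ^ 3 := by positivity
    rw [abs_mul, abs_of_pos hτ3] at h1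
    have h2 : |ψt (E4.ofTimeSpace τ y₀)| ≤ B * τ ^ (-(3 : ℝ)) := by
      rw [Real.rpow_neg hτ0.le, show ((3 : ℝ)) = ((3 : ℕ) : ℝ) by norm_num, Real.rpow_natCast,
        ← div_eq_mul_inv, le_div_iff₀ hτ3, mul_comm]
      exact h1
    exact h2.trans (mul_le_mul_of_nonneg_left hτe3 hB0)
  -- the increment along the path
  have hinc : |ψt (E4.ofTimeSpace τ y) - ψt (E4.ofTimeSpace τ y₀)| ≤
      Real.sqrt K * τ ^ (-2 + δ) * (6 * R') := by
    have t1 := abs_sub_le (ψt (E4.ofTimeSpace τ y)) (ψt (E4.ofTimeSpace τ yh))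
      (ψt (E4.ofTimeSpace τ y₀))
    have t2 := abs_sub_le (ψt (E4.ofTimeSpace τ yh)) (ψt (E4.ofTimeSpace τ v₁))
      (ψt (E4.ofTimeSpace τ y₀))
    rw [abs_sub_comm] at m₁ m₂ m₃
    linarith [m₁', m₂', m₃', abs_sub_comm (ψt (E4.ofTimeSpace τ y)) (ψt (E4.ofTimeSpace τ yh)),
      abs_sub_comm (ψt (E4.ofTimeSpace τ yh)) (ψt (E4.ofTimeSpace τ v₁)),
      abs_sub_comm (ψt (E4.ofTimeSpace τ v₁)) (ψt (E4.ofTimeSpace τ y₀))]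
  -- conclusion
  rw [hrep ⟨E4.ofTimeSpace τ y, hy⟩]
  change |ψt (E4.ofTimeSpace τ y)| ≤ _
  have htri : |ψt (E4.ofTimeSpace τ y)| ≤
      |ψt (E4.ofTimeSpace τ y₀)| + |ψt (E4.ofTimeSpace τ y) - ψt (E4.ofTimeSpace τ y₀)| := by
    have := abs_sub_abs_le_abs_sub (ψt (E4.ofTimeSpace τ y)) (ψt (E4.ofTimeSpace τ y₀))
    linarith [le_abs_self (|ψt (E4.ofTimeSpace τ y)| - |ψt (E4.ofTimeSpace τ y₀)|)]
  have hlast : Real.sqrt K * τ ^ (-2 + δ) * (6 * R') ≤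
      6 * R' * Real.sqrt K * τ ^ (-(3 / 2 : ℝ) + δ) := by
    have := mul_le_mul_of_nonneg_left hτe2
      (by positivity : (0 : ℝ) ≤ 6 * R' * Real.sqrt K)
    linarith
  calc |ψt (E4.ofTimeSpace τ y)|
      ≤ |ψt (E4.ofTimeSpace τ y₀)| + |ψt (E4.ofTimeSpace τ y) - ψt (E4.ofTimeSpace τ y₀)| := htri
    _ ≤ B * τ ^ (-(3 / 2 : ℝ) + δ) + 6 * R' * Real.sqrt K * τ ^ (-(3 / 2 : ℝ) + δ) :=
        add_le_add hpt (hinc.trans hlast)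
    _ = (B + 6 * R' * Real.sqrt K) * τ ^ (-(3 / 2 : ℝ) + δ) := by ring

end Literature.Geometry.Lorentzian

end
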